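import Summits.CriticalPhenomena.PercolationContinuityZ3.Theorems.Transplant.CayleyMilnorKernel
import HarnessLib

/-!
# Milnor's kernel lemma, III: unit-range alphabets — INPUT(Cay(Γ; S)) for the UNIVERSAL one-type node U is "an additive unit-range chart with
# unit steps in `S`", nothing about the kernel

builds on p205010 (kernel theorem, internal audit signed; external expert review pending) — nothing in this file uses p205010.  The theorems are
CONDITIONAL on the OPEN universal one-type node `SamePDropOfSkeletonFrmFrom₁` (= U, hypothesis `hN`; nothing is claimed about it) and on NOTHING ELSE.
Lane `prim-bschramm`, seat `prim-bschramm-p4` gen 17 (PART C3 of `P4-GENERAL.md` §39).  Helper file (`--supports stmt-CriticalPhenomena-4575`).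

`CayleyFrm₃ Γ S` (gen 13, file `CayleySkeletonFrmFrom`) = additive `φ : Γ → ℤ²` of unit range on `S` with unit steps in `S` AND a radius `r` such that
the kernel is generated by its elements of `S`-length `≤ r` (constructor `ofGens` from any finite generating set of the kernel); its rows are modulo U,
a node WEAKER than the scaled node `U_s` (`U_s ⟹ U`).  As in file II the kernel datum is automatic: ON exponential growth Hutchcroft's theorem applies, OFF
it Milnor's lemma (`Milnor.ker_fg_of_not_hasExponentialGrowth`) produces the finite generating set.  Hence
**`CayleyFrm₃.criticalContinuity_of_unitChart (hN : U) (φ) (map_mul) (lip) (step) (S) (hS) (g) : θ_g(p_c(Cay(Γ; S))) = 0`** — modulo U alone, for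
every group with an additive unit-range chart having unit steps in the alphabet `S` (every "flat" alphabet of ℤ^d, H₃(ℤ), N_{m,c}, …; no kernel hypothesis).
[cite: MilnorSolvableGrowth1968, Lemma 1 pp. 447–448] [cite: Hutchcroft2016, Thm. 1.1] [cite: BenjaminiSchramm1996, Conj. 4; §2 (Cayley graphs)]
-/

noncomputable section

namespace Summit.CriticalPhenomena.PercolationContinuityZ3.Theorems.Transplant

open SimpleGraph Literature.Barriers.CriticalPhenomena Literature.Probability.LatticeModels Literature.Probability.Percolation
open scoped Classical

namespace CayleyFrm₃

variable {Γ : Type} [Group Γ]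

/-- The `MonoidHom` `Γ →* Multiplicative ℤ²` of an additive chart. [folklore] -/
def chartHom (φ : Γ → Site 2) (map_mul : ∀ g h : Γ, φ (g * h) = φ g + φ h) : Γ →* Multiplicative (Site 2) where
  toFun g := Multiplicative.ofAdd (φ g)
  map_one' := by
    have h : φ 1 = 0 := by
      have := map_mul 1 1
      rw [mul_one] at this
      exact left_eq_add.1 this
    rw [h, ofAdd_zero]
  map_mul' g h := by rw [map_mul, ofAdd_add]

/-- `chartHom φ _ g = ofAdd (φ g)`. [folklore] -/
@[simp] theorem chartHom_apply (φ : Γ → Site 2) (map_mul : ∀ g h : Γ, φ (g * h) = φ g + φ h) (g : Γ) :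
    chartHom φ map_mul g = Multiplicative.ofAdd (φ g) := rfl

/-- The kernel of `chartHom φ` is `{φ = 0}`. [folklore] -/
theorem mem_ker_chartHom (φ : Γ → Site 2) (map_mul : ∀ g h : Γ, φ (g * h) = φ g + φ h) (g : Γ) :
    g ∈ (chartHom φ map_mul).ker ↔ φ g = 0 := by
  rw [MonoidHom.mem_ker, chartHom_apply, ← ofAdd_zero, Multiplicative.ofAdd.injective.eq_iff]

/-- **THEOREM (modulo the universal one-type node U ALONE): an additive unit-range chart with unit steps in `S` suffices** — no kernel hypothesis:
`θ_g(p_c(Cay(Γ; S))) = 0` at every vertex.  ON exponential growth by Hutchcroft; OFF it Milnor's lemma supplies `CayleyFrm₃.ofGens` with a finite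
generating set of the kernel. [cite: BenjaminiSchramm1996, Conj. 4; §2] [cite: Hutchcroft2016, Thm. 1.1] [cite: MilnorSolvableGrowth1968, Lemma 1] -/
theorem criticalContinuity_of_unitChart (hN : SamePDropOfSkeletonFrmFrom₁) (φ : Γ → Site 2) (map_mul : ∀ g h : Γ, φ (g * h) = φ g + φ h)
    (S : Finset Γ) (lip : ∀ s ∈ S, ∀ i : Fin 2, |φ s i| ≤ 1) (step : ∀ i : Fin 2, ∃ s ∈ S, φ s = Pi.single i 1)
    (hS : Subgroup.closure (S : Set Γ) = ⊤) (g : Γ) :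
    theta (mulCayley (↑S : Set Γ)) g (criticalProbIOf (mulCayley (↑S : Set Γ)) g) = 0 := by
  by_cases hG : HasExponentialGrowth (mulCayley (S : Set Γ))
  · exact Hutchcroft2016_noPercolationAtCriticality_holds _ (CayleyScaled.connected_mulCayley_of_closure S hS)
      (CayleyScaled.isQuasiTransitive_mulCayley S) hG g
  · obtain ⟨T, hT⟩ := Milnor.ker_fg_of_not_hasExponentialGrowth S hS hG (chartHom φ map_mul)
    have hT0 : ∀ t ∈ T, φ t = 0 := fun t ht =>
      (mem_ker_chartHom φ map_mul t).1 (by rw [← hT]; exact Subgroup.subset_closure (Finset.mem_coe.2 ht))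
    have hTk : ∀ k : Γ, φ k = 0 → k ∈ Subgroup.closure (T : Set Γ) := fun k hk => by
      rw [hT]; exact (mem_ker_chartHom φ map_mul k).2 hk
    exact (ofGens φ map_mul lip step hS T hT0 hTk).criticalContinuity_of_frmFromNode₁ hN g

/-- … and `θ_g(p) = 0` for every `p ≤ p_c`. [cite: BenjaminiSchramm1996, Conj. 4; §2] -/
theorem theta_eq_zero_of_le_of_unitChart (hN : SamePDropOfSkeletonFrmFrom₁) (φ : Γ → Site 2) (map_mul : ∀ g h : Γ, φ (g * h) = φ g + φ h)
    (S : Finset Γ) (lip : ∀ s ∈ S, ∀ i : Fin 2, |φ s i| ≤ 1) (step : ∀ i : Fin 2, ∃ s ∈ S, φ s = Pi.single i 1)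
    (hS : Subgroup.closure (S : Set Γ) = ⊤) (g : Γ) {p : unitInterval} (hp : (p : ℝ) ≤ criticalProb (mulCayley (↑S : Set Γ)) g) :
    theta (mulCayley (↑S : Set Γ)) g p = 0 := by
  haveI : Countable Γ := countable_of_connected_of_locallyFinite _ (CayleyScaled.connected_mulCayley_of_closure S hS) g
  rcases hp.lt_or_eq with hlt | heq
  · exact theta_eq_zero_of_lt_criticalProb_holds _ g p hlt
  · have e : p = criticalProbIOf (mulCayley (↑S : Set Γ)) g := Subtype.ext heq
    rw [e]
    exact criticalContinuity_of_unitChart hN φ map_mul S lip step hS g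

end CayleyFrm₃

end Summit.CriticalPhenomena.PercolationContinuityZ3.Theorems.Transplant

end
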